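import Mathlib
import HarnessLib
import Summits.ValiantsHypothesis.ValiantsHypothesis.Theses.PermanentalCones

/-!
# ValiantsHypothesis / PermanentalCones — `HyperbolicVPShadow`, symmetric case of stub B

Route `PermanentalCones`, item `stmt-ValiantsHypothesis-8655` (crux `HyperbolicVPShadow`), line
`birth`, stub `permanentalCones_realSpectrumCone_symmetric`.

Stub B of the line asks that the closed "nonnegative spectrum" cone
`{x : ∀ τ > 0, det (P x + τ·1) ≠ 0}` of a linear space of real matrices with only real
eigenvalues be a lifted-LMI set of quasi-polynomial size. This file records the classical base
case: if every `P x` is symmetric, the cone is exactly the spectrahedron `{x : P x ⪰ 0}` (size `N`,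
no lifting variables).

Proof. For a real symmetric `S`: if `S ⪰ 0` and `τ > 0` then `S + τ·1` is positive definite,
so `det (S + τ·1) > 0`. Conversely, if `S` is not positive semidefinite, some eigenvalue `λᵢ` of
`S` is negative; with `τ := -λᵢ > 0` the eigenvector `vᵢ ≠ 0` lies in the kernel of `S + τ·1`,
so `det (S + τ·1) = 0`.
-/

-- `<Problem> = <Summit>` for this single-conjunct summit (lakefile sets the same option tree-wide).
set_option linter.dupNamespace false

namespace Summit.ValiantsHypothesis.ValiantsHypothesis.Theorems

open Matrix

/-- A real symmetric matrix `S` has no negative eigenvalue — `det (S + τ·1) ≠ 0` for all `τ > 0` —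
iff it is positive semidefinite. [folklore] -/
theorem permanentalCones_forall_det_add_smul_one_ne_zero_iff {m : Type*} [Fintype m]
    [DecidableEq m] {S : Matrix m m ℝ} (hS : S.IsSymm) :
    (∀ τ : ℝ, 0 < τ → (S + τ • (1 : Matrix m m ℝ)).det ≠ 0) ↔ S.PosSemidef := by
  have hH : S.IsHermitian := Matrix.isHermitian_iff_isSymm.mpr hS
  refine ⟨fun h => ?_, fun h τ hτ => ?_⟩
  · rw [hH.posSemidef_iff_eigenvalues_nonneg]
    intro i
    by_contra hi
    refine h (-hH.eigenvalues i) (neg_pos.mpr (lt_of_not_ge hi)) ?_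
    rw [← Matrix.exists_mulVec_eq_zero_iff]
    refine ⟨⇑(hH.eigenvectorBasis i),
      (WithLp.ofLp_eq_zero 2).ne.2 (hH.eigenvectorBasis.orthonormal.ne_zero i), ?_⟩
    rw [Matrix.add_mulVec, Matrix.smul_mulVec, Matrix.one_mulVec,
      hH.mulVec_eigenvectorBasis i, ← add_smul, add_neg_cancel, zero_smul]
  · exact (Matrix.PosDef.posSemidef_add h (Matrix.PosDef.one.smul hτ)).det_pos.ne'

/-- **Symmetric case of stub B.** For a linear pencil `P` of real symmetric `N × N` matrices, the
closed nonnegative-spectrum cone `{x : ∀ τ > 0, det (P x + τ·1) ≠ 0}` is the spectrahedron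
`{x : P x ⪰ 0}`. [folklore] -/
theorem permanentalCones_realSpectrumCone_symmetric :
    ∀ (n N : ℕ) (P : (Fin n → ℝ) →ₗ[ℝ] Matrix (Fin N) (Fin N) ℝ), (∀ x : Fin n → ℝ, (P x).IsSymm) →
      ∀ x : Fin n → ℝ, (∀ τ : ℝ, 0 < τ → (P x + τ • (1 : Matrix (Fin N) (Fin N) ℝ)).det ≠ 0) ↔
        (P x).PosSemidef :=
  fun _ _ _ hP x => permanentalCones_forall_det_add_smul_one_ne_zero_iff (hP x)

/-- **Symmetric case of stub B, shadow form.** For a linear pencil `P` of real symmetric `N × N`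
matrices, the closed nonnegative-spectrum cone is a lifted-LMI set of size `N` with no lifting
variables (`p = 0`, `A (x, y) = P x`, `B = 0`). [folklore] -/
theorem permanentalCones_realSpectrumShadow_symmetric :
    ∀ (n N : ℕ) (P : (Fin n → ℝ) →ₗ[ℝ] Matrix (Fin N) (Fin N) ℝ), (∀ x : Fin n → ℝ, (P x).IsSymm) →
      ∃ (p : ℕ) (A : (Fin n → ℝ) × (Fin p → ℝ) →ₗ[ℝ] Matrix (Fin N) (Fin N) ℝ)
        (B : Matrix (Fin N) (Fin N) ℝ), ∀ x : Fin n → ℝ,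
        (∀ τ : ℝ, 0 < τ → (P x + τ • (1 : Matrix (Fin N) (Fin N) ℝ)).det ≠ 0) ↔
          ∃ y : Fin p → ℝ, (A (x, y) + B).PosSemidef := by
  intro n N P hP
  refine ⟨0, P ∘ₗ LinearMap.fst ℝ _ _, 0, fun x => ?_⟩
  rw [permanentalCones_realSpectrumCone_symmetric n N P hP x]
  simp

end Summit.ValiantsHypothesis.ValiantsHypothesis.Theorems
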